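import Literature.AlgebraicGeometry.ComplexMultiplication.EndomorphismFieldSignatureCondition
import Literature.AlgebraicGeometry.ComplexMultiplication.EndomorphismFieldIsogenyClasses
import HarnessLib

/-!
# The conjugate pair `(A, ῑ)`, `ῑ(a) = ι(ā)`: `𝓜(n − r, r)(ℂ) ≅ 𝓜(r, n − r)(ℂ)` on Shimura's pairs (the type is
# conjugated, the signature swapped); Pappas' wedge condition over `ℂ` in rank form

Topic `Literature/AlgebraicGeometry/ComplexMultiplication` (family `hodge`, lane `lit-hodgefound`; the ALGEBRAIC
carrier `Motives.AbelianVariety ℂ`, Shimura's pairs `(A, ι : F →+* A.endAlgebra)`, `[F : ℚ] = 2 dim A`, THE type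
`Φ = cmTypeOfPair ι hF`).  Sequel of `EndomorphismFieldSignatureCondition` (p11 g26-#3: the `(r, s)`-signature
condition `charpoly(δu | 𝔪_e/𝔪_e²) = (X − ψ(a))^r (X − ψ̄(a))^s` with `(r, s)` the multiplicities of THE type over the
imaginary quadratic `K₀ ≤ F`) and `EndomorphismFieldIsogenyClasses` (`comp_mem_cmTypeOfPair_comp_iff`: THE type of
the twisted pair `(A, ι ∘ e)` is `{σ ∘ e}`).

PRINTED STATEMENTS.  S. Kudla, M. Rapoport, *Special cycles on unitary Shimura varieties II: global theory*,
J. reine angew. Math. 697 (2014) [KudlaRapoport2013] (held `paper:arxiv-0912.3758`), §2: (2.1) «the following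
signature condition is imposed: `char(T, ι(a) | Lie A) = (T − a)^{n−r}(T − a^σ)^r`, `a ∈ 𝒪_K` […] In particular,
`A` is of relative dimension `n`»; after Example 2.3: «We note that there is a natural isomorphism between the moduli
stacks `𝓜(n−r, r)^naive` and `𝓜(r, n−r)^naive` which associates to `(A, ι, λ)` its conjugate `(A, ῑ, λ)`, where
the `𝒪_K`-action on `A` has been changed to its conjugate, i.e., `ῑ(a) = ι(a^σ)`»; Definition 2.5 (Pappas): «the
wedge condition: `∧^{n−r+1}(ι(a) − a) = 0`, `∧^{r+1}(ι(a) − a^σ) = 0`.  For `n ≤ 2`, this condition follows from the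
signature condition».  G. Shimura (1998) [Shimura1998], §8.5, proof of Prop. 30 («`S(ι(ξ^τ))` has the characteristic
roots `ξ^{τφ₁}, …, ξ^{τφₙ}`» — the type of `(A, ι ∘ τ)`), §18.2 Lemma (i) (`σ ∘ c = σ̄` on a CM field).

WHAT IS PROVED (hypotheses `(ιF : F →+* A.endAlgebra) (hF : finrank ℚ F = 2 * A.dim)`, `K₀ : IntermediateField ℚ F`;
`c = IsCMField.complexConj F`, the conjugate pair is `ιF.comp c`; `m_ψ` = `Fintype.card {σ : Φ.1 // σ|_{K₀} = ψ}`):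

* §1 (any `F`) **`finrank_range_cotangentMap_sub_smul`** — `rank(δu − μ | 𝔪_e/𝔪_e²) = dim A − #{σ ∈ Φ | σ(α) = μ}`
  (rank–nullity on the eigenbasis); for `K₀` imaginary quadratic **`finrank_range_cotangentMap_sub_smul_le`** — THE
  WEDGE CONDITION OVER `ℂ` in rank form (`∧^k f = 0 ⟺ rank f < k`): `rank(δu − ψ(a)) ≤ m_ψ̄ = s` for EVERY `a ∈ K₀`,
  in every dimension — and `finrank_range_cotangentMap_sub_smul_eq` (equality for `a` separating `ψ` from `ψ̄`).
* §2 (`F` a CM field) **`mem_cmTypeOfPair_comp_complexConj_iff`** (`σ ∈ Φ_{ι∘c} ⟺ σ̄ ∈ Φ_ι`: THE type of the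
  conjugate pair is `Φ̄`), `mem_cmTypeOfPair_comp_complexConj_iff_not_mem` (`= Hom(F, ℂ) ∖ Φ`),
  **`card_fibre_comp_complexConj`** (`m_ψ(A, ῑ) = m_ψ̄(A, ι)` for any subfield `K₀`), and for `K₀` imaginary quadratic
  **`forall_charpoly_comp_complexConj_eq_iff`** — THE `(r, s)`-CONDITION FOR `(A, ι)` ⟺ THE `(s, r)`-CONDITION FOR
  `(A, ῑ)` (KR's `𝓜(n−r, r) ≅ 𝓜(r, n−r)` on complex points with multiplication by `F`), `charpoly_comp_complexConj_eq`,
  `card_fibre_comp_complexConj_eq_one_iff` (special element above `ψ̄` ↔ above `ψ` for the conjugate pair).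

Theorems only; no definition, no named fact, no `sorry` (net debt 0); axioms `propext`, `Classical.choice`,
`Quot.sound`.

## References
* [KudlaRapoport2013] S. Kudla, M. Rapoport, *Special cycles on unitary Shimura varieties II: global theory*, J. reine
  angew. Math. 697 (2014) 91–157, §2 (2.1), Example 2.3 and the remark following it, Def. 2.5.
* [Shimura1998] G. Shimura, *Abelian Varieties with Complex Multiplication and Modular Functions* (1998), §5.2 (p. 39),
  §8.4 (1), §8.5 (proof of Prop. 30), §18.2 Lemma (i).
* [Howard2012] B. Howard, Ann. of Math. (2) 176 (2012), §1, §3.1.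

## Provenance

Lane `lit-hodgefound` (HOME `run/shared/lean/pub/lit-hodgefound/`), prover seat `lit-hodgefound-p11` (gen 26),
self-proposed row g26-#5 (INBOX claim 2026-08-27); new bib key `KudlaRapoport2013` (doi 10.1515/crelle-2012-0121).
-/

noncomputable section

namespace Literature.AlgebraicGeometry.ComplexMultiplication

open scoped Manifold Classical nonZeroDivisors Polynomial
open CategoryTheory NumberField Module Polynomial
open Literature.AlgebraicGeometry.Motives
open Literature.AlgebraicGeometry.HodgeTheory
open Literature.NumberTheory.ComplexMultiplication

namespace EndFieldFullDegree

variable {F : Type} [Field F] [NumberField F] {A : AbelianVariety ℂ}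
  (ιF : F →+* A.endAlgebra) (hF : finrank ℚ F = 2 * A.dim) (K₀ : IntermediateField ℚ F)

/-! ### §1 Pappas' wedge condition over `ℂ`, in rank form: `rank(δu − ψ(a)) ≤ s`, with equality for separating `a` -/

/-- `ker(δu − μ) = Eig_μ(δu)`. [folklore] -/
private theorem ker_sub_smul_eq_eigenspace (f : Module.End ℂ (Motives.AbelianVariety.Cotangent A)) (μ : ℂ) :
    LinearMap.ker (f - μ • LinearMap.id) = Module.End.eigenspace f μ := by
  ext v
  rw [LinearMap.mem_ker, Module.End.mem_eigenspace_iff, LinearMap.sub_apply, LinearMap.smul_apply, LinearMap.id_apply,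
    sub_eq_zero]

/-- **`rank(δu − μ | 𝔪_e/𝔪_e²) = dim A − #{σ ∈ Φ | σ(α) = μ}`** for `1 ⊗ u = ι(α)` (rank–nullity and the eigenvalue
count on the eigenbasis, `finrank_eigenspace_cotangentMap_eq_card`). [cite: Shimura1998, §5.2, p. 39]
[cite: KudlaRapoport2013, §2 Def. 2.5 (the wedge condition)] -/
theorem finrank_range_cotangentMap_sub_smul {α : F} {u : End A} (hu : AbelianVariety.endAlgebra.of A u = ιF α) (μ : ℂ) :
    finrank ℂ (LinearMap.range (Motives.AbelianVariety.cotangentMap A u - μ • LinearMap.id)) =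
      A.dim - Fintype.card {σ : (cmTypeOfPair ιF hF).1 // σ.1 α = μ} := by
  have h := LinearMap.finrank_range_add_finrank_ker (Motives.AbelianVariety.cotangentMap A u - μ • LinearMap.id)
  rw [ker_sub_smul_eq_eigenspace, finrank_eigenspace_cotangentMap_eq_card ιF hF hu μ,
    Motives.AbelianVariety.finrank_cotangent] at h
  omega

section Quadratic

variable [IsTotallyComplex K₀]

/-- `ψ̄ ≠ ψ`. [folklore] -/
private theorem conjugate_ne'' (ψ : K₀ →+* ℂ) : ComplexEmbedding.conjugate ψ ≠ ψ := fun h =>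
  IsTotallyComplex.complexEmbedding_not_isReal ψ (ComplexEmbedding.isReal_iff.2 h)

/-- `[K₀ : ℚ] = 2`: every complex embedding of `K₀` is `ψ` or `ψ̄`. [cite: Shimura1998, §8.4 (1)] -/
private theorem eq_or_eq_conjugate'' (hK₀ : finrank ℚ K₀ = 2) (ψ χ : K₀ →+* ℂ) :
    χ = ψ ∨ χ = ComplexEmbedding.conjugate ψ := by
  by_contra h
  push Not at h
  have h3 := Fintype.two_lt_card_iff.2 ⟨χ, ψ, ComplexEmbedding.conjugate ψ, h.1, h.2, (conjugate_ne'' K₀ ψ).symm⟩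
  rw [Embeddings.card, hK₀] at h3
  exact lt_irrefl _ h3

omit [IsTotallyComplex K₀] in
/-- The members of `Φ` above `ψ` all have `σ(a) = ψ(a)`: `m_ψ ≤ #{σ ∈ Φ | σ(a) = ψ(a)}`. [folklore] -/
private theorem card_fibre_le_card_eq (ψ : K₀ →+* ℂ) (a : K₀) :
    Fintype.card {σ : (cmTypeOfPair ιF hF).1 // σ.1.comp (algebraMap K₀ F) = ψ} ≤
      Fintype.card {σ : (cmTypeOfPair ιF hF).1 // σ.1 (algebraMap K₀ F a) = ψ a} := by
  refine Fintype.card_le_of_injective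
    (fun σ => (⟨σ.1, RingHom.congr_fun σ.2 a⟩ : {σ : (cmTypeOfPair ιF hF).1 // σ.1 (algebraMap K₀ F a) = ψ a}))
    fun σ τ h => by
      have h' := congrArg (fun x : {σ : (cmTypeOfPair ιF hF).1 // σ.1 (algebraMap K₀ F a) = ψ a} => x.1) h
      exact Subtype.ext (by simpa using h')

/-- **PAPPAS' WEDGE CONDITION `∧^{s+1}(ι(a) − a) = 0` HOLDS OVER `ℂ`, in rank form**: for every `a ∈ K₀` and
`1 ⊗ u = ι(a)`, `rank(δu − ψ(a) | 𝔪_e/𝔪_e²) ≤ m_ψ̄ = s` (the `m_ψ` eigenforms above `ψ` are killed; «for `n ≤ 2`, this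
condition follows from the signature condition» — over `ℂ` it follows in every dimension, `δu` being diagonalisable).
[cite: KudlaRapoport2013, §2 Def. 2.5 and the sentence following it] [cite: Shimura1998, §5.2, p. 39] -/
theorem finrank_range_cotangentMap_sub_smul_le (hK₀ : finrank ℚ K₀ = 2) (ψ : K₀ →+* ℂ) {a : K₀} {u : End A}
    (hu : AbelianVariety.endAlgebra.of A u = ιF (algebraMap K₀ F a)) :
    finrank ℂ (LinearMap.range (Motives.AbelianVariety.cotangentMap A u - (ψ a : ℂ) • LinearMap.id)) ≤
      Fintype.card {σ : (cmTypeOfPair ιF hF).1 //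
        σ.1.comp (algebraMap K₀ F) = ComplexEmbedding.conjugate ψ} := by
  rw [finrank_range_cotangentMap_sub_smul ιF hF hu]
  have h1 := card_fibre_le_card_eq ιF hF K₀ ψ a
  have h2 := card_fibre_add_card_fibre_conjugate_eq_dim ιF hF K₀ hK₀ ψ
  omega

/-- **… with EQUALITY `rank(δu − ψ(a)) = s` as soon as `a` separates `ψ` from `ψ̄`** (then `σ(a) = ψ(a) ⟺ σ|_{K₀} = ψ`).
[cite: KudlaRapoport2013, §2 (2.1) and Def. 2.5] [cite: Shimura1998, §5.2, p. 39] -/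
theorem finrank_range_cotangentMap_sub_smul_eq (hK₀ : finrank ℚ K₀ = 2) (ψ : K₀ →+* ℂ) {a : K₀}
    (ha : ComplexEmbedding.conjugate ψ a ≠ ψ a) {u : End A}
    (hu : AbelianVariety.endAlgebra.of A u = ιF (algebraMap K₀ F a)) :
    finrank ℂ (LinearMap.range (Motives.AbelianVariety.cotangentMap A u - (ψ a : ℂ) • LinearMap.id)) =
      Fintype.card {σ : (cmTypeOfPair ιF hF).1 //
        σ.1.comp (algebraMap K₀ F) = ComplexEmbedding.conjugate ψ} := by
  rw [finrank_range_cotangentMap_sub_smul ιF hF hu,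
    ← finrank_eigenspace_cotangentMap_eq_card ιF hF hu, finrank_eigenspace_cotangentMap_eq_card_fibre ιF hF K₀ hK₀ ψ ha hu]
  have h2 := card_fibre_add_card_fibre_conjugate_eq_dim ιF hF K₀ hK₀ ψ
  omega

end Quadratic

/-! ### §2 The conjugate pair `(A, ι ∘ c)`: THE type is conjugated, the signature is swapped -/

section Conjugate

variable [IsCMField F]

/-- **THE type of the conjugate pair `(A, ῑ)`, `ῑ(a) = ι(ā)`, is the conjugate type `Φ̄`**: `σ ∈ Φ_{ι∘c} ⟺ σ̄ ∈ Φ_ι`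
(«`S(ι(ξ^τ))` has the characteristic roots `ξ^{τφᵢ}`», `comp_mem_cmTypeOfPair_comp_iff` with `τ = c`, and
`σ ∘ c = σ̄` on a CM field). [cite: KudlaRapoport2013, §2 (after Example 2.3)] [cite: Shimura1998, §8.5 (proof of Prop. 30); §18.2 Lemma (i)] -/
theorem mem_cmTypeOfPair_comp_complexConj_iff (σ : F →+* ℂ) :
    σ ∈ (cmTypeOfPair (ιF.comp (IsCMField.complexConj F : F →+* F)) hF).1 ↔
      ComplexEmbedding.conjugate σ ∈ (cmTypeOfPair ιF hF).1 := by
  have hsurj : Function.Surjective (IsCMField.complexConj F : F →+* F) := (IsCMField.complexConj F).surjective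
  have key := comp_mem_cmTypeOfPair_comp_iff ιF hF (IsCMField.complexConj F : F →+* F) hsurj hF
    (ComplexEmbedding.conjugate σ)
  have hcomp : (ComplexEmbedding.conjugate σ).comp (IsCMField.complexConj F : F →+* F) = σ := by
    refine RingHom.ext fun x => ?_
    rw [RingHom.comp_apply, ComplexEmbedding.conjugate_coe_eq]
    change starRingEnd ℂ (σ (IsCMField.complexConj F x)) = σ x
    rw [IsCMField.complexEmbedding_complexConj, starRingEnd_self_apply]
  rw [hcomp] at key
  exact key

/-- Equivalently `σ ∈ Φ_{ι∘c} ⟺ σ ∉ Φ_ι`: **the conjugate pair has the complementary type `Φ̄ = Hom(F, ℂ) ∖ Φ`**.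
[cite: KudlaRapoport2013, §2 (after Example 2.3)] [cite: Shimura1998, §8.5 (proof of Prop. 30)] -/
theorem mem_cmTypeOfPair_comp_complexConj_iff_not_mem (σ : F →+* ℂ) :
    σ ∈ (cmTypeOfPair (ιF.comp (IsCMField.complexConj F : F →+* F)) hF).1 ↔ σ ∉ (cmTypeOfPair ιF hF).1 := by
  rw [mem_cmTypeOfPair_comp_complexConj_iff, (cmTypeOfPair ιF hF).2 σ, not_not]

/-- **The multiplicities of the conjugate pair are swapped**: `m_ψ(A, ῑ) = m_ψ̄(A, ι)` for every subfield `K₀ ≤ F`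
and every embedding `ψ` of `K₀` (conjugation `σ ↦ σ̄` maps the one fibre of THE types onto the other).
[cite: KudlaRapoport2013, §2 («a natural isomorphism between `𝓜(n−r, r)` and `𝓜(r, n−r)` which associates to
`(A, ι, λ)` its conjugate `(A, ῑ, λ)`»)] -/
theorem card_fibre_comp_complexConj (ψ : K₀ →+* ℂ) :
    Fintype.card {σ : (cmTypeOfPair (ιF.comp (IsCMField.complexConj F : F →+* F)) hF).1 //
        σ.1.comp (algebraMap K₀ F) = ψ} =
      Fintype.card {σ : (cmTypeOfPair ιF hF).1 // σ.1.comp (algebraMap K₀ F) = ComplexEmbedding.conjugate ψ} := by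
  refine Fintype.card_congr
    { toFun := fun σ => ⟨⟨ComplexEmbedding.conjugate σ.1.1,
        (mem_cmTypeOfPair_comp_complexConj_iff ιF hF σ.1.1).1 σ.1.2⟩, ?_⟩
      invFun := fun σ => ⟨⟨ComplexEmbedding.conjugate σ.1.1, ?_⟩, ?_⟩
      left_inv := fun σ => Subtype.ext (Subtype.ext (ComplexEmbedding.involutive_conjugate F σ.1.1))
      right_inv := fun σ => Subtype.ext (Subtype.ext (ComplexEmbedding.involutive_conjugate F σ.1.1)) }
  · change (ComplexEmbedding.conjugate σ.1.1).comp (algebraMap K₀ F) = ComplexEmbedding.conjugate ψ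
    rw [← conjugate_comp_ringHom, σ.2]
  · rw [mem_cmTypeOfPair_comp_complexConj_iff, ComplexEmbedding.involutive_conjugate F σ.1.1]
    exact σ.1.2
  · change (ComplexEmbedding.conjugate σ.1.1).comp (algebraMap K₀ F) = ψ
    rw [← conjugate_comp_ringHom, σ.2]
    exact ComplexEmbedding.involutive_conjugate _ ψ

variable [IsTotallyComplex K₀]

include hF in
/-- **`𝓜(n − r, r)(ℂ) ≅ 𝓜(r, n − r)(ℂ)` on Shimura's pairs: the `(r, s)`-signature condition for `(A, ι)` is
EQUIVALENT to the `(s, r)`-signature condition for the conjugate pair `(A, ῑ)`, `ῑ = ι ∘ c`** — both read on the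
characteristic polynomial of the `K₀`-action on `𝔪_e/𝔪_e²` (`forall_charpoly_eq_iff_card_fibre_eq` twice and the
swap `card_fibre_comp_complexConj`). [cite: KudlaRapoport2013, §2 (2.1) and the remark after Example 2.3]
[cite: Howard2012, §1] -/
theorem forall_charpoly_comp_complexConj_eq_iff (hK₀ : finrank ℚ K₀ = 2) (ψ : K₀ →+* ℂ) (r s : ℕ) :
    (∀ (a : K₀) (u : End A),
        AbelianVariety.endAlgebra.of A u = (ιF.comp (IsCMField.complexConj F : F →+* F)) (algebraMap K₀ F a) →
      (Motives.AbelianVariety.cotangentMap A u).charpoly =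
        (X - C (ψ a : ℂ)) ^ s * (X - C (ComplexEmbedding.conjugate ψ a : ℂ)) ^ r) ↔
    ∀ (a : K₀) (u : End A), AbelianVariety.endAlgebra.of A u = ιF (algebraMap K₀ F a) →
      (Motives.AbelianVariety.cotangentMap A u).charpoly =
        (X - C (ψ a : ℂ)) ^ r * (X - C (ComplexEmbedding.conjugate ψ a : ℂ)) ^ s := by
  rw [forall_charpoly_eq_iff_card_fibre_eq (ιF.comp (IsCMField.complexConj F : F →+* F)) hF K₀ hK₀ ψ s r,
    forall_charpoly_eq_iff_card_fibre_eq ιF hF K₀ hK₀ ψ r s, card_fibre_comp_complexConj, card_fibre_comp_complexConj,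
    ComplexEmbedding.involutive_conjugate _ ψ]
  exact and_comm

include hF in
/-- One direction, as used: **a CM point of `𝓜(r, s)(ℂ)` with multiplication by `F` is, with the conjugate action,
a CM point of `𝓜(s, r)(ℂ)` on the SAME abelian variety.** [cite: KudlaRapoport2013, §2 (after Example 2.3)] -/
theorem charpoly_comp_complexConj_eq (hK₀ : finrank ℚ K₀ = 2) (ψ : K₀ →+* ℂ) {r s : ℕ}
    (h : ∀ (a : K₀) (u : End A), AbelianVariety.endAlgebra.of A u = ιF (algebraMap K₀ F a) →
      (Motives.AbelianVariety.cotangentMap A u).charpoly =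
        (X - C (ψ a : ℂ)) ^ r * (X - C (ComplexEmbedding.conjugate ψ a : ℂ)) ^ s)
    {a : K₀} {u : End A}
    (hu : AbelianVariety.endAlgebra.of A u = (ιF.comp (IsCMField.complexConj F : F →+* F)) (algebraMap K₀ F a)) :
    (Motives.AbelianVariety.cotangentMap A u).charpoly =
      (X - C (ψ a : ℂ)) ^ s * (X - C (ComplexEmbedding.conjugate ψ a : ℂ)) ^ r :=
  (forall_charpoly_comp_complexConj_eq_iff ιF hF K₀ hK₀ ψ r s).2 h a u hu

omit [IsTotallyComplex K₀] in
/-- **A special element above `ψ̄` for `(A, ι)` is a special element above `ψ` for the conjugate pair**: the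
multiplicity-one eigencharacter moves from `ψ̄` to `ψ` (signature `(n − 1, 1) ↔ (1, n − 1)`).
[cite: KudlaRapoport2013, §2 (after Example 2.3)] [cite: Howard2012, §3.1] -/
theorem card_fibre_comp_complexConj_eq_one_iff (ψ : K₀ →+* ℂ) :
    Fintype.card {σ : (cmTypeOfPair (ιF.comp (IsCMField.complexConj F : F →+* F)) hF).1 //
        σ.1.comp (algebraMap K₀ F) = ψ} = 1 ↔
      Fintype.card {σ : (cmTypeOfPair ιF hF).1 //
        σ.1.comp (algebraMap K₀ F) = ComplexEmbedding.conjugate ψ} = 1 := by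
  rw [card_fibre_comp_complexConj]

end Conjugate

end EndFieldFullDegree

end Literature.AlgebraicGeometry.ComplexMultiplication

end
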